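import Summits.HodgeConjecture.CorCM.Census.OcticDecicWeilDefect
import HarnessLib

/-!
# `E × B₄ × B₅` over an octic and a decic CM field sharing `k`: the PARTS of a balanced configuration — conjugate pairs, Weil SIXFOLD
# parts (`B₄ × E × E`, `B₅ × E`), TENFOLD parts (`E × B₄ × B̄₅`) and FOURTEENFOLD parts (`B₄ × B̄₅ × B̄₅`)

COR-CM (cell `pub-hodgecm2`), seat b30 gen 27 (2026-08-23); count-neutral own lane OCTIC-DECIC, sequel of
`Census/OcticDecicWeil{,Defect}.lean`; the degree-`(8,10)` twin of `Census/SexticDecicWeilParts.lean`.  Seven bookkeeping definitions (the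
part predicates) and theorems of the finite model; no named fact, no geometry, no `sorry`, no `decide`.  Splittings and balance follow in
`Census/OcticDecicWeilPartsBalanced.lean`, extraction and induction in `Census/OcticDecicWeilExtraction.lean`.

For a configuration `(T, v : α → PtOD)` (the coordinates of a product of copies of `E, B₄, B₅` with their labels):
* `IsPairPartOD v G` — two points with labels `{y, ȳ}` (a divisor weight);
* `IsQuadPartOD v b G` / `IsFivePartOD v b G` — one point over each fourfold label `(1, a, b)`, `a < 4` / each fivefold label `(2, a, b)`,
  `a < 5` (the halves `⋀⁴ H¹(B₄)_b`, `⋀⁵ H¹(B₅)_b`; NOT Hodge classes);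
* `IsSixFourPartOD v b G` — TWO curve points over `τ_b` plus a quad part of sign `b`: a lift of the Weil weight `2[τ_b] + Σ_a[(1,a,b)]` of the
  SIXFOLD `B₄ × E × E` (`k`-signature `(1,3) + (1,0) + (1,0) = (3,3)`);
* `IsSixFivePartOD v b G` — a curve point over `τ_b` plus a five part of sign `b`: a lift of the Weil weight of the SIXFOLD `B₅ × E`
  (`k`-signature `(2,3) + (1,0) = (3,3)`);
* `IsTenPartOD v b G` — a curve point over `τ_b`, a quad part of sign `b`, a five part of sign `¬b`: a lift of the Weil weight of the TENFOLD
  `E × B₄ × B̄₅` (`k`-signature `(1,0) + (1,3) + (3,2) = (5,5)`);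
* `IsFourteenPartOD v b G` — a quad part of sign `b` and TWO points over each `(2, a, ¬b)` (two copies of `B̄₅`): a lift of the Weil weight of
  the FOURTEENFOLD `B₄ × B̄₅ × B̄₅` (`k`-signature `(1,3) + (3,2) + (3,2) = (7,7)`).
This file: the definitions, the count functions of the elementary parts, their selection from the counts, the evaluated counts.
[cite: MoonenZarhin1995Duke, Thm. 2.4] [cite: Gordon1999HodgeAVSurvey, 5.13 (ii), 9.2.2] [cite: Milne2020HodgeClassesAV, 1.2 (a)]

## References
* [MoonenZarhin1995Duke] B. Moonen, Yu. Zarhin, Duke Math. J. 77 (1995), Thm. 2.4.  [Gordon1999HodgeAVSurvey] B. B. Gordon, CRM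
  Monogr. 10 (1999), 5.13 (ii), 9.2.2.  [Milne2020HodgeClassesAV] J. S. Milne, arXiv:2010.08857, 1.2 (a).
-/

namespace Summit.HodgeConjecture.CorCM.Census.OcticDecicWeil

open Finset

variable {α : Type*} {v : α → PtOD}

/-! ### The parts -/

/-- **A pair part**: two points over a conjugate pair of labels `{y, cjOD y}` (a divisor weight, possibly spread over two copies).
[cite: Gordon1999HodgeAVSurvey, 9.2.2] -/
def IsPairPartOD (v : α → PtOD) (G : Finset α) : Prop :=
  ∃ y : PtOD, G.card = 2 ∧ Set.InjOn v ↑G ∧ G.image v = {y, cjOD y}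

/-- **A quad part of sign `b`**: one point over each fourfold label `(1, a, b)` — the weight of `⋀⁴ H¹(B₄)_b` (NOT a Hodge class).
[cite: MoonenZarhin1995Duke, Thm. 2.4] -/
def IsQuadPartOD (v : α → PtOD) (b : Bool) (G : Finset α) : Prop :=
  G.card = 4 ∧ ∀ a : Fin 4, (G.filter fun x => v x = Sum.inr (Sum.inl (a, b))).card = 1

/-- **A five part of sign `b`**: one point over each fivefold label `(2, a, b)` — the weight of `⋀⁵ H¹(B₅)_b` (NOT a Hodge class).
[cite: MoonenZarhin1995Duke, Thm. 2.4] -/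
def IsFivePartOD (v : α → PtOD) (b : Bool) (G : Finset α) : Prop :=
  G.card = 5 ∧ ∀ a : Fin 5, (G.filter fun x => v x = Sum.inr (Sum.inr (a, b))).card = 1

/-- **A Weil SIXFOLD part of the fourfold slot, sign `b`**: TWO curve points over `τ_b` and a quad part of sign `b` — a lift of the Weil
weight `2[τ_b] + Σ_a [(1, a, b)]` of `B₄ × E × E`. [cite: MoonenZarhin1995Duke, Thm. 2.4] [cite: Gordon1999HodgeAVSurvey, 5.13 (ii)] -/
def IsSixFourPartOD (v : α → PtOD) (b : Bool) (G : Finset α) : Prop :=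
  G.card = 6 ∧ (G.filter fun x => v x = Sum.inl b).card = 2 ∧ ∀ a : Fin 4, (G.filter fun x => v x = Sum.inr (Sum.inl (a, b))).card = 1

/-- **A Weil SIXFOLD part of the fivefold slot, sign `b`**: one curve point over `τ_b` and a five part of sign `b` — a lift of the Weil
weight `[τ_b] + Σ_a [(2, a, b)]` of `B₅ × E`. [cite: MoonenZarhin1995Duke, Thm. 2.4] [cite: Gordon1999HodgeAVSurvey, 5.13 (ii)] -/
def IsSixFivePartOD (v : α → PtOD) (b : Bool) (G : Finset α) : Prop :=
  G.card = 6 ∧ (G.filter fun x => v x = Sum.inl b).card = 1 ∧ ∀ a : Fin 5, (G.filter fun x => v x = Sum.inr (Sum.inr (a, b))).card = 1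

/-- **A Weil TENFOLD part of sign `b`**: one curve point over `τ_b`, a quad part of sign `b`, a five part of sign `¬b` — a lift of the Weil
weight of the tenfold `E × B₄ × B̄₅`. [cite: MoonenZarhin1995Duke, Thm. 2.4] [cite: Gordon1999HodgeAVSurvey, 5.13 (ii)] -/
def IsTenPartOD (v : α → PtOD) (b : Bool) (G : Finset α) : Prop :=
  G.card = 10 ∧ (G.filter fun x => v x = Sum.inl b).card = 1 ∧
    (∀ a : Fin 4, (G.filter fun x => v x = Sum.inr (Sum.inl (a, b))).card = 1) ∧
      ∀ a : Fin 5, (G.filter fun x => v x = Sum.inr (Sum.inr (a, !b))).card = 1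

/-- **A Weil FOURTEENFOLD part of sign `b`**: a quad part of sign `b` and TWO points over each `(2, a, ¬b)` (two copies of `B̄₅`) — a lift
of the Weil weight of the fourteenfold `B₄ × B̄₅ × B̄₅`. [cite: MoonenZarhin1995Duke, Thm. 2.4] [cite: Gordon1999HodgeAVSurvey, 5.13 (ii)] -/
def IsFourteenPartOD (v : α → PtOD) (b : Bool) (G : Finset α) : Prop :=
  G.card = 14 ∧ (∀ a : Fin 4, (G.filter fun x => v x = Sum.inr (Sum.inl (a, b))).card = 1) ∧
    ∀ a : Fin 5, (G.filter fun x => v x = Sum.inr (Sum.inr (a, !b))).card = 2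

/-! ### Count functions of the elementary parts -/

/-- The count function of a pair part: `1` on `y` and `cjOD y`, `0` elsewhere. [folklore] -/
theorem IsPairPartOD.count_eq [DecidableEq α] {G : Finset α} (hG : IsPairPartOD v G) : ∃ y : PtOD, ∀ z : PtOD,
    (G.filter fun x => v x = z).card = if z = y ∨ z = cjOD y then 1 else 0 := by
  obtain ⟨y, hcard, hinj, himg⟩ := hG
  refine ⟨y, fun z => ?_⟩
  have hfib : ∀ z, (G.filter fun x => v x = z).card = if z ∈ G.image v then 1 else 0 := by
    intro z
    split_ifs with hz
    · obtain ⟨x, hx, rfl⟩ := Finset.mem_image.1 hz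
      rw [Finset.card_eq_one]
      refine ⟨x, Finset.eq_singleton_iff_unique_mem.2 ⟨Finset.mem_filter.2 ⟨hx, rfl⟩, fun x' hx' => ?_⟩⟩
      exact hinj (Finset.mem_of_mem_filter _ hx') hx (Finset.mem_filter.1 hx').2
    · rw [Finset.card_eq_zero, Finset.filter_eq_empty_iff]
      exact fun x hx hxz => hz (hxz ▸ Finset.mem_image_of_mem v hx)
  rw [hfib z, himg]
  simp only [Finset.mem_insert, Finset.mem_singleton]

/-- The fibres over pairwise distinct labels `f a` (`f` injective) and one further fibre fit into `G`. [folklore] -/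
private theorem sum_fibres_add_le {n : ℕ} (G : Finset α) {f : Fin n → PtOD} (hf : Function.Injective f) {z : PtOD}
    (hz : ∀ a, z ≠ f a) :
    ∑ a : Fin n, (G.filter fun x => v x = f a).card + (G.filter fun x => v x = z).card ≤ G.card := by
  classical
  have hpd : ∀ a ∈ (univ : Finset (Fin n)), ∀ a' ∈ (univ : Finset (Fin n)), a ≠ a' →
      Disjoint (G.filter fun x => v x = f a) (G.filter fun x => v x = f a') :=
    fun a _ a' _ haa => Finset.disjoint_filter.2 fun x _ h1 h2 => haa (hf (h1.symm.trans h2))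
  have hdisj : Disjoint ((univ : Finset (Fin n)).biUnion fun a => G.filter fun x => v x = f a) (G.filter fun x => v x = z) :=
    (Finset.disjoint_biUnion_left _ _ _).2 fun a _ => Finset.disjoint_filter.2 fun x _ h1 h2 => hz a (h2.symm.trans h1)
  rw [← Finset.card_biUnion hpd, ← Finset.card_union_of_disjoint hdisj]
  exact Finset.card_le_card (Finset.union_subset (Finset.biUnion_subset.2 fun a _ => Finset.filter_subset _ _)
    (Finset.filter_subset _ _))

/-- The fourfold labels `(1, a, b)`, `a < 4`, are pairwise distinct. [folklore] -/
theorem inr_inl_injective (b : Bool) : Function.Injective fun a : Fin 4 => (Sum.inr (Sum.inl (a, b)) : PtOD) :=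
  fun a a' h => by simpa using h

/-- The fivefold labels `(2, a, b)`, `a < 5`, are pairwise distinct. [folklore] -/
theorem inr_inr_injective (b : Bool) : Function.Injective fun a : Fin 5 => (Sum.inr (Sum.inr (a, b)) : PtOD) :=
  fun a a' h => by simpa using h

/-- The count function of a quad part of sign `b`: `1` on the four `(1, a, b)`, `0` elsewhere. [folklore] -/
theorem IsQuadPartOD.count_eq {b : Bool} {G : Finset α} (hG : IsQuadPartOD v b G) (z : PtOD) :
    (G.filter fun x => v x = z).card = if ∃ a : Fin 4, z = Sum.inr (Sum.inl (a, b)) then 1 else 0 := by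
  classical
  obtain ⟨hcard, hB⟩ := hG
  split_ifs with hz
  · obtain ⟨a, rfl⟩ := hz
    exact hB a
  · push Not at hz
    have hle := sum_fibres_add_le (v := v) G (inr_inl_injective b) hz
    simp only [hB, Finset.sum_const, Finset.card_univ, Fintype.card_fin, smul_eq_mul, mul_one, hcard] at hle
    omega

/-- The count function of a five part of sign `b`: `1` on the five `(2, a, b)`, `0` elsewhere. [folklore] -/
theorem IsFivePartOD.count_eq {b : Bool} {G : Finset α} (hG : IsFivePartOD v b G) (z : PtOD) :
    (G.filter fun x => v x = z).card = if ∃ a : Fin 5, z = Sum.inr (Sum.inr (a, b)) then 1 else 0 := by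
  classical
  obtain ⟨hcard, hB⟩ := hG
  split_ifs with hz
  · obtain ⟨a, rfl⟩ := hz
    exact hB a
  · push Not at hz
    have hle := sum_fibres_add_le (v := v) G (inr_inr_injective b) hz
    simp only [hB, Finset.sum_const, Finset.card_univ, Fintype.card_fin, smul_eq_mul, mul_one, hcard] at hle
    omega

/-! ### Elementary properties of quad and five parts -/

/-- Every point of a quad part lies over a label `(1, a, b)`. [folklore] -/
theorem IsQuadPartOD.exists_eq {b : Bool} {G : Finset α} (hG : IsQuadPartOD v b G) {x : α} (hx : x ∈ G) :
    ∃ a : Fin 4, v x = Sum.inr (Sum.inl (a, b)) := by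
  classical
  have hpos : 0 < (G.filter fun x' => v x' = v x).card := Finset.card_pos.2 ⟨x, Finset.mem_filter.2 ⟨hx, rfl⟩⟩
  rw [hG.count_eq] at hpos
  by_contra h
  rw [if_neg h] at hpos
  exact lt_irrefl 0 hpos

/-- Every point of a five part lies over a label `(2, a, b)`. [folklore] -/
theorem IsFivePartOD.exists_eq {b : Bool} {G : Finset α} (hG : IsFivePartOD v b G) {x : α} (hx : x ∈ G) :
    ∃ a : Fin 5, v x = Sum.inr (Sum.inr (a, b)) := by
  classical
  have hpos : 0 < (G.filter fun x' => v x' = v x).card := Finset.card_pos.2 ⟨x, Finset.mem_filter.2 ⟨hx, rfl⟩⟩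
  rw [hG.count_eq] at hpos
  by_contra h
  rw [if_neg h] at hpos
  exact lt_irrefl 0 hpos

/-- The model map is injective on a quad part. [folklore] -/
theorem IsQuadPartOD.injOn {b : Bool} {G : Finset α} (hG : IsQuadPartOD v b G) : Set.InjOn v ↑G := by
  classical
  intro x hx x' hx' h
  have hle : (G.filter fun y => v y = v x).card ≤ 1 := by
    rw [hG.count_eq]; split_ifs <;> omega
  exact Finset.card_le_one.1 hle x (Finset.mem_filter.2 ⟨hx, rfl⟩) x' (Finset.mem_filter.2 ⟨hx', h.symm⟩)

/-- The model map is injective on a five part. [folklore] -/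
theorem IsFivePartOD.injOn {b : Bool} {G : Finset α} (hG : IsFivePartOD v b G) : Set.InjOn v ↑G := by
  classical
  intro x hx x' hx' h
  have hle : (G.filter fun y => v y = v x).card ≤ 1 := by
    rw [hG.count_eq]; split_ifs <;> omega
  exact Finset.card_le_one.1 hle x (Finset.mem_filter.2 ⟨hx, rfl⟩) x' (Finset.mem_filter.2 ⟨hx', h.symm⟩)

/-- A pair part is non-empty. [folklore] -/
theorem IsPairPartOD.nonempty {G : Finset α} (hG : IsPairPartOD v G) : G.Nonempty := by
  obtain ⟨_, hcard, -⟩ := hG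
  rw [← Finset.card_pos, hcard]; norm_num

/-- A quad part inside `T` from the counts: one point over each `(1, a, b)`. [folklore] -/
theorem exists_quadPartOD_of_counts [DecidableEq α] {T : Finset α} (b : Bool)
    (hB : ∀ a : Fin 4, 0 < (T.filter fun x => v x = Sum.inr (Sum.inl (a, b))).card) : ∃ G ⊆ T, IsQuadPartOD v b G := by
  have hpick : ∀ a : Fin 4, ∃ x ∈ T, v x = Sum.inr (Sum.inl (a, b)) := fun a => by
    obtain ⟨x, hx⟩ := Finset.card_pos.1 (hB a)
    exact ⟨x, (Finset.mem_filter.1 hx).1, (Finset.mem_filter.1 hx).2⟩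
  choose pick hpickT hpickv using hpick
  have hpinj : Function.Injective pick := fun a a' h => by
    have e := hpickv a
    rw [h, hpickv a'] at e
    have : a' = a := by simpa using e
    exact this.symm
  refine ⟨univ.image pick, fun x hx => by obtain ⟨a, -, rfl⟩ := Finset.mem_image.1 hx; exact hpickT a, ?_, fun a => ?_⟩
  · rw [Finset.card_image_of_injective _ hpinj, Finset.card_univ, Fintype.card_fin]
  · rw [Finset.card_eq_one]
    refine ⟨pick a, ?_⟩
    ext x
    simp only [Finset.mem_filter, Finset.mem_image, Finset.mem_univ, true_and, Finset.mem_singleton]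
    constructor
    · rintro ⟨⟨a', rfl⟩, hvx⟩
      rw [hpickv a'] at hvx
      have : a' = a := by simpa using hvx
      rw [this]
    · rintro rfl
      exact ⟨⟨a, rfl⟩, hpickv a⟩

/-- A five part inside `T` from the counts: one point over each `(2, a, b)`. [folklore] -/
theorem exists_fivePartOD_of_counts [DecidableEq α] {T : Finset α} (b : Bool)
    (hB : ∀ a : Fin 5, 0 < (T.filter fun x => v x = Sum.inr (Sum.inr (a, b))).card) : ∃ G ⊆ T, IsFivePartOD v b G := by
  have hpick : ∀ a : Fin 5, ∃ x ∈ T, v x = Sum.inr (Sum.inr (a, b)) := fun a => by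
    obtain ⟨x, hx⟩ := Finset.card_pos.1 (hB a)
    exact ⟨x, (Finset.mem_filter.1 hx).1, (Finset.mem_filter.1 hx).2⟩
  choose pick hpickT hpickv using hpick
  have hpinj : Function.Injective pick := fun a a' h => by
    have e := hpickv a
    rw [h, hpickv a'] at e
    have : a' = a := by simpa using e
    exact this.symm
  refine ⟨univ.image pick, fun x hx => by obtain ⟨a, -, rfl⟩ := Finset.mem_image.1 hx; exact hpickT a, ?_, fun a => ?_⟩
  · rw [Finset.card_image_of_injective _ hpinj, Finset.card_univ, Fintype.card_fin]
  · rw [Finset.card_eq_one]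
    refine ⟨pick a, ?_⟩
    ext x
    simp only [Finset.mem_filter, Finset.mem_image, Finset.mem_univ, true_and, Finset.mem_singleton]
    constructor
    · rintro ⟨⟨a', rfl⟩, hvx⟩
      rw [hpickv a'] at hvx
      have : a' = a := by simpa using hvx
      rw [this]
    · rintro rfl
      exact ⟨⟨a, rfl⟩, hpickv a⟩

/-- A pair part inside `T` from the counts: one point over `y` and one over `cjOD y`. [folklore] -/
theorem exists_pairPartOD_of_counts [DecidableEq α] {T : Finset α} (y : PtOD)
    (hy : 0 < (T.filter fun x => v x = y).card) (hcy : 0 < (T.filter fun x => v x = cjOD y).card) :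
    ∃ G ⊆ T, IsPairPartOD v G := by
  obtain ⟨x, hx₀⟩ := Finset.card_pos.1 hy
  obtain ⟨hxT, hx⟩ := Finset.mem_filter.1 hx₀
  obtain ⟨x', hx₀'⟩ := Finset.card_pos.1 hcy
  obtain ⟨hx'T, hx'⟩ := Finset.mem_filter.1 hx₀'
  have hne : x ≠ x' := by
    intro h
    apply cjOD_ne y
    rw [← hx', ← h, hx]
  refine ⟨{x, x'}, ?_, y, Finset.card_pair hne, ?_, ?_⟩
  · intro z hz
    rcases Finset.mem_insert.1 hz with rfl | hz
    · exact hxT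
    · rw [Finset.mem_singleton.1 hz]; exact hx'T
  · intro z hz z' hz' hzz'
    simp only [Finset.coe_insert, Finset.coe_singleton, Set.mem_insert_iff, Set.mem_singleton_iff] at hz hz'
    rcases hz with rfl | rfl <;> rcases hz' with rfl | rfl
    · rfl
    · exfalso; rw [hx, hx'] at hzz'; exact cjOD_ne y hzz'.symm
    · exfalso; rw [hx, hx'] at hzz'; exact cjOD_ne y hzz'
    · rfl
  · rw [Finset.image_insert, Finset.image_singleton, hx, hx']

/-! ### The count functions in evaluated form -/

/-- A quad part: no point over the curve labels. [folklore] -/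
theorem IsQuadPartOD.card_filter_inl {b : Bool} {G : Finset α} (hG : IsQuadPartOD v b G) (b' : Bool) :
    (G.filter fun x => v x = Sum.inl b').card = 0 := by
  classical
  rw [hG.count_eq, if_neg]
  rintro ⟨a, ha⟩
  exact Sum.inl_ne_inr ha

/-- A quad part: one point over `(1, a, b)`, none over the other fourfold labels. [folklore] -/
theorem IsQuadPartOD.card_filter_inr_inl {b : Bool} {G : Finset α} (hG : IsQuadPartOD v b G) (a : Fin 4) (b' : Bool) :
    (G.filter fun x => v x = Sum.inr (Sum.inl (a, b'))).card = if b' = b then 1 else 0 := by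
  classical
  rw [hG.count_eq]
  by_cases h : b' = b
  · subst h; rw [if_pos ⟨a, rfl⟩, if_pos rfl]
  · rw [if_neg h, if_neg]
    rintro ⟨a', ha'⟩
    simp only [Sum.inr.injEq, Sum.inl.injEq, Prod.mk.injEq] at ha'
    exact h ha'.2

/-- A quad part: no point over the fivefold labels. [folklore] -/
theorem IsQuadPartOD.card_filter_inr_inr {b : Bool} {G : Finset α} (hG : IsQuadPartOD v b G) (a : Fin 5) (b' : Bool) :
    (G.filter fun x => v x = Sum.inr (Sum.inr (a, b'))).card = 0 := by
  classical
  rw [hG.count_eq, if_neg]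
  rintro ⟨a', ha'⟩
  simp only [Sum.inr.injEq] at ha'
  exact Sum.inr_ne_inl ha'

/-- A five part: no point over the curve labels. [folklore] -/
theorem IsFivePartOD.card_filter_inl {b : Bool} {G : Finset α} (hG : IsFivePartOD v b G) (b' : Bool) :
    (G.filter fun x => v x = Sum.inl b').card = 0 := by
  classical
  rw [hG.count_eq, if_neg]
  rintro ⟨a, ha⟩
  exact Sum.inl_ne_inr ha

/-- A five part: no point over the fourfold labels. [folklore] -/
theorem IsFivePartOD.card_filter_inr_inl {b : Bool} {G : Finset α} (hG : IsFivePartOD v b G) (a : Fin 4) (b' : Bool) :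
    (G.filter fun x => v x = Sum.inr (Sum.inl (a, b'))).card = 0 := by
  classical
  rw [hG.count_eq, if_neg]
  rintro ⟨a', ha'⟩
  simp only [Sum.inr.injEq] at ha'
  exact Sum.inl_ne_inr ha'

/-- A five part: one point over `(2, a, b)`, none over the other fivefold labels. [folklore] -/
theorem IsFivePartOD.card_filter_inr_inr {b : Bool} {G : Finset α} (hG : IsFivePartOD v b G) (a : Fin 5) (b' : Bool) :
    (G.filter fun x => v x = Sum.inr (Sum.inr (a, b'))).card = if b' = b then 1 else 0 := by
  classical
  rw [hG.count_eq]
  by_cases h : b' = b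
  · subst h; rw [if_pos ⟨a, rfl⟩, if_pos rfl]
  · rw [if_neg h, if_neg]
    rintro ⟨a', ha'⟩
    simp only [Sum.inr.injEq, Prod.mk.injEq] at ha'
    exact h ha'.2

end Summit.HodgeConjecture.CorCM.Census.OcticDecicWeil
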